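import Summits.HubbardSuperconductivity.HubbardSuperconductivity.Theorems.LevyLogBootstrapDressHalfFilledKernelSymmetry
import Literature.MathematicalPhysics.QuantumLattice.TorusPlaquetteHamiltonian
import HarnessLib

/-!
# Route `LevyLogBootstrap` / `AnisotropyChord`, crux `DressHalfFilled` (stmt-HubbardSuperconductivity-8148), stub 2
# `stub_plaquetteDictionary`, clause (d) — torus geometry: the INTER-plaquette bonds of the checkerboard torus

Support file (`--supports stmt-HubbardSuperconductivity-8148`). In the summit's statements the checkerboard Hubbard
torus of side `L = 2M` is `hamiltonian G_intra 1 U + hamiltonian G_inter t' 0` with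
`G_inter = fermionTorusGraph 2 L ⊓ SimpleGraph.comap (fun x i => (x i : ℕ)/2) ⊤` (torus bonds joining DIFFERENT `2 × 2`
blocks). With the plaquette coordinates `plaqSite M R a = 2R + a` of `TorusPlaquettePartition` this file proves the
bond geometry used by the second-order (Kato) kernel of clause (d) of the plaquette-boson dictionary:

* `plaqNbr R k = R + e_k` — the neighbouring plaquette of the plaquette torus `(ℤ/M)²` in direction `k`
  (coordinatewise `Fin M` addition; `toTorusSite_plaqNbr`: its `ZMod` coordinates are `toTorusSite R + e_k`);
* `adj_plaqSite_iff` — nearest-neighbour adjacency of `2R + a` and `2R' + b` on the `2M`-torus in plaquette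
  coordinates (a unit step inside a block or across to the next block), `M ≥ 2`;
* **`interGraph_adj_plaqSite_iff`** — `2R + a ∼ 2R' + b` in `G_inter` iff for some direction `k` either
  `R' = R + e_k` and `(a, b)` is one of the two horizontal (`k = 0`, `plaquetteBonds`) / vertical (`k = 1`,
  `plaquetteBondsV`) boundary bonds, or the same with the roles of the two sites exchanged. In words: the
  inter-plaquette bonds are exactly the ORIENTED superlattice bonds `(R, R + e_k)` times the two-element bond sets
  of `PlaquettePairCouplings` / `…KernelSymmetry` — the indexing under which the kernels are summed in
  `…KernelXXZBondSum`.

The registered sub-goal `dressHalfFilled_interAdjIff` (signature verbatim as registered on the item) is the closed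
form of `interGraph_adj_plaqSite_iff`.

References: H. Yao, W.-F. Tsai, S. A. Kivelson, PRB 76 (2007) 161104(R), Fig. 1 (dashed bonds) [YaoTsaiKivelson2007];
W.-F. Tsai, S. A. Kivelson, PRB 73 (2006) 214510, §I [TsaiKivelson2006]. Tree: `TorusPlaquette.plaqSite`,
`blockOf_plaqSite`, `blockOf_eq_iff` (`TorusPlaquettePartition`), `torusGraph_adj_iff` (`LatticeGraph`),
`plaquetteBonds` (`PlaquettePairCouplings`), `plaquetteBondsV` (`…KernelSymmetry`); the proofs follow
`HubbardTorusPlaquetteDressedBound.adj_cellSite_iff` (same geometry in the `M * 2` convention). One definition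
(`plaqNbr`, the object named by the registered stubs `dressHalfFilled_interAdjIff` / `dressHalfFilled_interHoppingBondSum`)
is introduced; all statements are [folklore].
-/

set_option linter.dupNamespace false

noncomputable section

namespace Summit.HubbardSuperconductivity.HubbardSuperconductivity.Theorems.LevyLogBootstrap

open Literature.MathematicalPhysics.QuantumLattice Literature.Probability.LatticeModels
open Literature.MathematicalPhysics.QuantumLattice.TorusPlaquette

section InterBonds

variable {M : ℕ}

/-! ### The neighbouring plaquette `R + e_k` -/

section Nbr

variable [NeZero M]

/-- **The neighbouring plaquette** `plaqNbr R k = R + e_k` of the plaquette `R` of the plaquette torus `(ℤ/M)²`, in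
direction `k` (coordinatewise `Fin M` addition, i.e. modulo `M`). Yao–Tsai–Kivelson 2007, Fig. 1.
[cite: YaoTsaiKivelson2007, Fig. 1] -/
def plaqNbr (R : FermionTorus 2 M) (k : Fin 2) : FermionTorus 2 M :=
  toLex (ofLex R + Pi.single k 1)

/-- Coordinates of the neighbouring plaquette. [folklore] -/
theorem ofLex_plaqNbr (R : FermionTorus 2 M) (k : Fin 2) : ofLex (plaqNbr R k) = ofLex R + Pi.single k 1 := rfl

/-- The `k`-th coordinate of `R + e_k` is `R_k + 1`. [folklore] -/
theorem plaqNbr_apply_same (R : FermionTorus 2 M) (k : Fin 2) : ofLex (plaqNbr R k) k = ofLex R k + 1 := by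
  rw [ofLex_plaqNbr, Pi.add_apply, Pi.single_eq_same]

/-- The other coordinate of `R + e_k` is that of `R`. [folklore] -/
theorem plaqNbr_apply_of_ne (R : FermionTorus 2 M) {k j : Fin 2} (h : j ≠ k) :
    ofLex (plaqNbr R k) j = ofLex R j := by
  rw [ofLex_plaqNbr, Pi.add_apply, Pi.single_eq_of_ne h, add_zero]

/-- `R' = R + e_k` in coordinates. [folklore] -/
theorem eq_plaqNbr_iff (R R' : FermionTorus 2 M) (k : Fin 2) :
    R' = plaqNbr R k ↔ ofLex R' k = ofLex R k + 1 ∧ ∀ j, j ≠ k → ofLex R' j = ofLex R j := by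
  constructor
  · rintro rfl
    exact ⟨plaqNbr_apply_same R k, fun j hj => plaqNbr_apply_of_ne R hj⟩
  · rintro ⟨hk, hj⟩
    rw [← toLex_ofLex R', ← toLex_ofLex (plaqNbr R k)]
    congr 1
    funext j
    by_cases h : j = k
    · subst h; rw [hk, plaqNbr_apply_same]
    · rw [hj j h, plaqNbr_apply_of_ne R h]

/-- The value of the stepped coordinate: `(R + e_k)_k = (R_k + 1) mod M`. [folklore] -/
theorem val_plaqNbr_same (R : FermionTorus 2 M) (k : Fin 2) :
    ((ofLex (plaqNbr R k) k : Fin M) : ℕ) = ((ofLex R k : ℕ) + 1) % M := by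
  rw [plaqNbr_apply_same, Fin.val_add]
  rcases Nat.lt_or_ge 1 M with h1 | h1
  · rw [Fin.val_one', Nat.mod_eq_of_lt h1]
  · have hM : M = 1 := le_antisymm h1 (Nat.pos_of_ne_zero (NeZero.ne M))
    subst hM
    simp

/-- In the statistical-mechanics coordinates `(ℤ/M)²`: `toTorusSite (R + e_k) = toTorusSite R + e_k`. [folklore] -/
theorem toTorusSite_plaqNbr (R : FermionTorus 2 M) (k : Fin 2) :
    FermionTorus.toTorusSite (plaqNbr R k) = FermionTorus.toTorusSite R + Pi.single k 1 := by
  funext j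
  rw [Pi.add_apply, FermionTorus.toTorusSite_apply, FermionTorus.toTorusSite_apply]
  by_cases h : j = k
  · subst h
    rw [Pi.single_eq_same, val_plaqNbr_same, ZMod.natCast_mod, Nat.cast_add, Nat.cast_one]
  · rw [Pi.single_eq_of_ne h, add_zero, plaqNbr_apply_of_ne R h]

/-- For `M ≥ 2` a plaquette differs from its neighbours. [folklore] -/
theorem plaqNbr_ne (hM : 2 ≤ M) (R : FermionTorus 2 M) (k : Fin 2) : plaqNbr R k ≠ R := by
  intro h
  have h1 : ((ofLex (plaqNbr R k) k : Fin M) : ℕ) = (ofLex R k : ℕ) := by rw [h]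
  rw [val_plaqNbr_same] at h1
  have hc := (ofLex R k).isLt
  rcases Nat.lt_or_ge ((ofLex R k : ℕ) + 1) M with hlt | hge
  · rw [Nat.mod_eq_of_lt hlt] at h1; omega
  · have heq : (ofLex R k : ℕ) + 1 = M := by omega
    rw [heq, Nat.mod_self] at h1; omega

/-! ### One torus coordinate in plaquette form `2c + a` -/

/-- One coordinate of the torus `ℤ/2M` in plaquette form `u = 2c + a`: `v = u + 1 (mod 2M)` iff `(a, b) = (0, 1)`
inside the block `c' = c`, or `(a, b) = (1, 0)` across to the next block `c' = c + 1` (`M ≥ 2`). [folklore] -/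
theorem cast_plaq_eq_add_one_iff (hM : 2 ≤ M) (c c' : Fin M) (a b : Fin 2) :
    (((2 * (c' : ℕ) + (b : ℕ) : ℕ) : ZMod (2 * M)) = ((2 * (c : ℕ) + (a : ℕ) : ℕ) : ZMod (2 * M)) + 1) ↔
      (a = 0 ∧ b = 1 ∧ c' = c) ∨ (a = 1 ∧ b = 0 ∧ c' = c + 1) := by
  have ha := a.isLt; have hb := b.isLt; have hc := c.isLt; have hc' := c'.isLt
  have hcast : ((2 * (c : ℕ) + (a : ℕ) : ℕ) : ZMod (2 * M)) + 1 =
      ((2 * (c : ℕ) + (a : ℕ) + 1 : ℕ) : ZMod (2 * M)) := by push_cast; ring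
  rw [hcast, ZMod.natCast_eq_natCast_iff', Nat.mod_eq_of_lt (by omega : 2 * (c' : ℕ) + b < 2 * M)]
  have hstep : c' = c + 1 ↔ ((c' : ℕ) = c + 1 ∨ ((c : ℕ) + 1 = M ∧ (c' : ℕ) = 0)) := by
    rw [Fin.ext_iff, Fin.val_add, Fin.val_one', Nat.mod_eq_of_lt (by omega : 1 < M)]
    rcases Nat.lt_or_ge ((c : ℕ) + 1) M with h | h
    · rw [Nat.mod_eq_of_lt h]; omega
    · rw [show (c : ℕ) + 1 = M by omega, Nat.mod_self]; omega
  have hmod : (2 * (c : ℕ) + a + 1) % (2 * M) =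
      if 2 * (c : ℕ) + a + 1 < 2 * M then 2 * (c : ℕ) + a + 1 else 0 := by
    split_ifs with h
    · exact Nat.mod_eq_of_lt h
    · rw [show 2 * (c : ℕ) + a + 1 = 2 * M by omega, Nat.mod_self]
  rw [hmod, hstep, Fin.ext_iff, Fin.ext_iff, Fin.ext_iff, Fin.ext_iff, Fin.ext_iff]
  simp only [Fin.val_zero, Fin.val_one]
  split_ifs with h <;> omega

end Nbr

/-- Equality of one torus coordinate in plaquette form. [folklore] -/
theorem cast_plaq_eq_iff (c c' : Fin M) (a b : Fin 2) :
    (((2 * (c' : ℕ) + (b : ℕ) : ℕ) : ZMod (2 * M)) = ((2 * (c : ℕ) + (a : ℕ) : ℕ) : ZMod (2 * M))) ↔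
      c' = c ∧ b = a := by
  have ha := a.isLt; have hb := b.isLt; have hc := c.isLt; have hc' := c'.isLt
  rw [ZMod.natCast_eq_natCast_iff', Nat.mod_eq_of_lt (by omega : 2 * (c' : ℕ) + b < 2 * M),
    Nat.mod_eq_of_lt (by omega : 2 * (c : ℕ) + a < 2 * M), Fin.ext_iff, Fin.ext_iff]
  omega

/-- The statistical-mechanics coordinates of a plaquette site: `(2R + a)_i = 2R_i + a_i (mod 2M)`. [folklore] -/
theorem toTorusSite_plaqSite (R : FermionTorus 2 M) (a : PlaquetteSite) (i : Fin 2) :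
    FermionTorus.toTorusSite (plaqSite M R a) i = ((2 * (ofLex R i : ℕ) + (ofLex a i : ℕ) : ℕ) : ZMod (2 * M)) :=
  rfl

section Adj

variable [NeZero M]

/-- A unit step of the `2M`-torus in plaquette coordinates: `2R' + b = (2R + a) + e_i` iff the two sites agree off
the `i`-th coordinate and the `i`-th coordinate steps inside the block (`a_i = 0`, `b_i = 1`, `R'_i = R_i`) or into the
next block (`a_i = 1`, `b_i = 0`, `R'_i = R_i + 1`). [folklore] -/
theorem toTorusSite_plaqSite_eq_add_single_iff (hM : 2 ≤ M) (R R' : FermionTorus 2 M)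
    (a b : PlaquetteSite) (i : Fin 2) :
    FermionTorus.toTorusSite (plaqSite M R' b) = FermionTorus.toTorusSite (plaqSite M R a) + Pi.single i 1 ↔
      (∀ j, j ≠ i → ofLex R' j = ofLex R j ∧ ofLex b j = ofLex a j) ∧
        ((ofLex a i = 0 ∧ ofLex b i = 1 ∧ ofLex R' i = ofLex R i) ∨
          (ofLex a i = 1 ∧ ofLex b i = 0 ∧ ofLex R' i = ofLex R i + 1)) := by
  rw [funext_iff]
  constructor
  · intro h
    refine ⟨fun j hj => ?_, ?_⟩
    · have hj' := h j
      rw [Pi.add_apply, Pi.single_eq_of_ne hj, add_zero, toTorusSite_plaqSite, toTorusSite_plaqSite,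
        cast_plaq_eq_iff] at hj'
      exact hj'
    · have hi := h i
      rw [Pi.add_apply, Pi.single_eq_same, toTorusSite_plaqSite, toTorusSite_plaqSite,
        cast_plaq_eq_add_one_iff hM] at hi
      exact hi
  · rintro ⟨hoff, hi⟩ j
    by_cases hj : j = i
    · subst hj
      rw [Pi.add_apply, Pi.single_eq_same, toTorusSite_plaqSite, toTorusSite_plaqSite,
        cast_plaq_eq_add_one_iff hM]
      exact hi
    · rw [Pi.add_apply, Pi.single_eq_of_ne hj, add_zero, toTorusSite_plaqSite, toTorusSite_plaqSite,
        cast_plaq_eq_iff]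
      exact hoff j hj

/-- **Nearest-neighbour adjacency of the `2M`-torus in plaquette coordinates** (`M ≥ 2`): the two sites agree off
one coordinate `i`, along which one of them is the unit step of the other, inside a block or across to the
neighbouring block. [cite: YaoTsaiKivelson2007, Fig. 1] -/
theorem adj_plaqSite_iff (hM : 2 ≤ M) (R R' : FermionTorus 2 M) (a b : PlaquetteSite) :
    (fermionTorusGraph 2 (2 * M)).Adj (plaqSite M R a) (plaqSite M R' b) ↔
      ∃ i : Fin 2, (∀ j, j ≠ i → ofLex R' j = ofLex R j ∧ ofLex b j = ofLex a j) ∧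
        (((ofLex a i = 0 ∧ ofLex b i = 1 ∧ ofLex R' i = ofLex R i) ∨
            (ofLex a i = 1 ∧ ofLex b i = 0 ∧ ofLex R' i = ofLex R i + 1)) ∨
         ((ofLex b i = 0 ∧ ofLex a i = 1 ∧ ofLex R i = ofLex R' i) ∨
            (ofLex b i = 1 ∧ ofLex a i = 0 ∧ ofLex R i = ofLex R' i + 1))) := by
  haveI : Fact (1 < 2 * M) := ⟨by omega⟩
  rw [fermionTorusGraph_adj, torusGraph_adj_iff]
  constructor
  · rintro ⟨-, ⟨i, hi⟩ | ⟨i, hi⟩⟩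
    · obtain ⟨hoff, hst⟩ := (toTorusSite_plaqSite_eq_add_single_iff hM R R' a b i).1 hi
      exact ⟨i, hoff, Or.inl hst⟩
    · obtain ⟨hoff, hst⟩ := (toTorusSite_plaqSite_eq_add_single_iff hM R' R b a i).1 hi
      exact ⟨i, fun j hj => ⟨((hoff j hj).1).symm, ((hoff j hj).2).symm⟩, Or.inr hst⟩
  · rintro ⟨i, hoff, hst | hst⟩
    · have h := (toTorusSite_plaqSite_eq_add_single_iff hM R R' a b i).2 ⟨hoff, hst⟩
      refine ⟨fun heq => ?_, Or.inl ⟨i, h⟩⟩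
      have := congrFun h i
      rw [heq, Pi.add_apply, Pi.single_eq_same, left_eq_add] at this
      exact one_ne_zero this
    · have h := (toTorusSite_plaqSite_eq_add_single_iff hM R' R b a i).2
        ⟨fun j hj => ⟨((hoff j hj).1).symm, ((hoff j hj).2).symm⟩, hst⟩
      refine ⟨fun heq => ?_, Or.inr ⟨i, h⟩⟩
      have := congrFun h i
      rw [← heq, Pi.add_apply, Pi.single_eq_same, left_eq_add] at this
      exact one_ne_zero this

end Adj

/-- Membership in the horizontal (`k = 0`, `plaquetteBonds`) / vertical (`k = 1`, `plaquetteBondsV`) boundary bond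
set, in coordinates: the first site has `k`-th coordinate `1`, the second `0`, and they agree in the other
coordinate. [folklore] -/
theorem mem_plaquetteBonds_vec_iff : ∀ (k : Fin 2) (a b : PlaquetteSite),
    (a, b) ∈ (![plaquetteBonds, plaquetteBondsV] : Fin 2 → Finset (PlaquetteSite × PlaquetteSite)) k ↔
      ofLex a k = 1 ∧ ofLex b k = 0 ∧ ∀ j, j ≠ k → ofLex b j = ofLex a j := by
  decide

/-- Adjacency in the summit's inter-plaquette graph `G_inter = G ⊓ comap (block map) ⊤`: torus adjacency AND
different blocks. [folklore] -/
theorem interGraph_adj (x y : FermionTorus 2 (2 * M)) :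
    (fermionTorusGraph 2 (2 * M) ⊓ SimpleGraph.comap
        (fun x : FermionTorus 2 (2 * M) => fun i : Fin 2 => ((ofLex x) i : ℕ) / 2) ⊤).Adj x y ↔
      (fermionTorusGraph 2 (2 * M)).Adj x y ∧ blockOf M x ≠ blockOf M y := by
  rw [SimpleGraph.inf_adj, SimpleGraph.comap_adj, SimpleGraph.top_adj, ne_eq, ← blockOf_eq_iff]

/-- **Adjacency across plaquettes** (`M ≥ 2`): the sites `2R + a`, `2R' + b` are joined by a bond of the
inter-plaquette graph `G_inter` iff, for some direction `k`, EITHER `R' = R + e_k` and `(a, b)` is one of the two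
`k`-boundary bonds (`plaquetteBonds` for `k = 0`, `plaquetteBondsV` for `k = 1`), OR `R = R' + e_k` and `(b, a)` is.
The inter-plaquette bonds are the oriented superlattice bonds `(R, R + e_k)` times the two-element bond sets.
[cite: YaoTsaiKivelson2007, Fig. 1] -/
theorem interGraph_adj_plaqSite_iff [NeZero M] (hM : 2 ≤ M) (R R' : FermionTorus 2 M) (a b : PlaquetteSite) :
    (fermionTorusGraph 2 (2 * M) ⊓ SimpleGraph.comap
        (fun x : FermionTorus 2 (2 * M) => fun i : Fin 2 => ((ofLex x) i : ℕ) / 2) ⊤).Adj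
        (plaqSite M R a) (plaqSite M R' b) ↔
      ∃ k : Fin 2, (R' = plaqNbr R k ∧ (a, b) ∈ (![plaquetteBonds, plaquetteBondsV] : Fin 2 →
          Finset (PlaquetteSite × PlaquetteSite)) k) ∨
        (R = plaqNbr R' k ∧ (b, a) ∈ (![plaquetteBonds, plaquetteBondsV] : Fin 2 →
          Finset (PlaquetteSite × PlaquetteSite)) k) := by
  rw [interGraph_adj, blockOf_plaqSite, blockOf_plaqSite, adj_plaqSite_iff hM]
  simp only [mem_plaquetteBonds_vec_iff, eq_plaqNbr_iff]
  constructor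
  · rintro ⟨⟨i, hoff, (⟨ha, hb, hR⟩ | ⟨ha, hb, hR⟩) | (⟨hb, ha, hR⟩ | ⟨hb, ha, hR⟩)⟩, hne⟩
    · refine absurd ?_ hne
      rw [← toLex_ofLex R, ← toLex_ofLex R']
      congr 1
      funext j
      by_cases hj : j = i
      · subst hj; exact hR.symm
      · exact ((hoff j hj).1).symm
    · exact ⟨i, Or.inl ⟨⟨hR, fun j hj => (hoff j hj).1⟩, ha, hb, fun j hj => (hoff j hj).2⟩⟩
    · refine absurd ?_ hne
      rw [← toLex_ofLex R, ← toLex_ofLex R']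
      congr 1
      funext j
      by_cases hj : j = i
      · subst hj; exact hR
      · exact ((hoff j hj).1).symm
    · exact ⟨i, Or.inr ⟨⟨hR, fun j hj => ((hoff j hj).1).symm⟩, hb, ha, fun j hj => ((hoff j hj).2).symm⟩⟩
  · rintro ⟨k, (⟨⟨hR, hoffR⟩, ha, hb, hoff⟩ | ⟨⟨hR, hoffR⟩, hb, ha, hoff⟩)⟩
    · refine ⟨⟨k, fun j hj => ⟨hoffR j hj, hoff j hj⟩, Or.inl (Or.inr ⟨ha, hb, hR⟩)⟩, fun h => ?_⟩
      have h' : R' = plaqNbr R k := (eq_plaqNbr_iff R R' k).2 ⟨hR, hoffR⟩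
      exact plaqNbr_ne hM R k (h'.symm.trans h.symm)
    · refine ⟨⟨k, fun j hj => ⟨(hoffR j hj).symm, (hoff j hj).symm⟩, Or.inr (Or.inr ⟨hb, ha, hR⟩)⟩, fun h => ?_⟩
      have h' : R = plaqNbr R' k := (eq_plaqNbr_iff R' R k).2 ⟨hR, hoffR⟩
      exact plaqNbr_ne hM R' k (h'.symm.trans h)

end InterBonds

/-! ### Registered form -/

set_option linter.style.longLine false in
/-- **Registered sub-goal `dressHalfFilled_interAdjIff`** (closed form, signature verbatim as registered on the crux
item stmt-HubbardSuperconductivity-8148): clause (d) torus geometry — adjacency across plaquettes of the checkerboard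
torus of side `2M`, `M ≥ 2`, = oriented superlattice bonds `(R, R + e_k)` × the bond sets
`![plaquetteBonds, plaquetteBondsV] k`. [cite: YaoTsaiKivelson2007, Fig. 1] -/
theorem dressHalfFilled_interAdjIff : ∀ {M : ℕ} [NeZero M], 2 ≤ M → ∀ (R R' : Literature.MathematicalPhysics.QuantumLattice.FermionTorus 2 M) (a b : Literature.MathematicalPhysics.QuantumLattice.PlaquetteSite), (Literature.MathematicalPhysics.QuantumLattice.fermionTorusGraph 2 (2 * M) ⊓ SimpleGraph.comap (fun x : Literature.MathematicalPhysics.QuantumLattice.FermionTorus 2 (2 * M) => fun i : Fin 2 => ((ofLex x) i : ℕ) / 2) ⊤).Adj (Literature.MathematicalPhysics.QuantumLattice.TorusPlaquette.plaqSite M R a) (Literature.MathematicalPhysics.QuantumLattice.TorusPlaquette.plaqSite M R' b) ↔ ∃ k : Fin 2, (R' = Summit.HubbardSuperconductivity.HubbardSuperconductivity.Theorems.LevyLogBootstrap.plaqNbr R k ∧ (a, b) ∈ (![Literature.MathematicalPhysics.QuantumLattice.plaquetteBonds, Summit.HubbardSuperconductivity.HubbardSuperconductivity.Theorems.LevyLogBootstrap.plaquetteBondsV]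 : Fin 2 → Finset (Literature.MathematicalPhysics.QuantumLattice.PlaquetteSite × Literature.MathematicalPhysics.QuantumLattice.PlaquetteSite)) k) ∨ (R = Summit.HubbardSuperconductivity.HubbardSuperconductivity.Theorems.LevyLogBootstrap.plaqNbr R' k ∧ (b, a) ∈ (![Literature.MathematicalPhysics.QuantumLattice.plaquetteBonds, Summit.HubbardSuperconductivity.HubbardSuperconductivity.Theorems.LevyLogBootstrap.plaquetteBondsV] : Fin 2 → Finset (Literature.MathematicalPhysics.QuantumLattice.PlaquetteSite × Literature.MathematicalPhysics.QuantumLattice.PlaquetteSite)) k) :=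
  fun hM R R' a b => interGraph_adj_plaqSite_iff hM R R' a b

end Summit.HubbardSuperconductivity.HubbardSuperconductivity.Theorems.LevyLogBootstrap

end
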